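import Summits.Ventures.HSemireg.ObstructionLocusGraph

/-!
# Venture HSemireg — (S5) OBSTRUCTION LOCUS away from secant type, IV: companions — the TWIST LEMMA (b-twists are
# harmless and nothing else is) and the closed forms of (S-B)(b) (Jacobian excess `C(n−2,2)`), (e) (`e₁ = n²`),
# and the Porteous row (`h^{0,2} = n(2n−1)`)

HONEST FRAMING.  Part of the Lean side of the computation cell `pub-hsemireg` (track «S4-PUSH» (ii), seat s4-prove-2).
Theorems only (no new definition); finite linear algebra and arithmetic over an arbitrary field / over `ℕ`; nothing here
says that HC / HC_CM / HC_AV holds; no Literature fact is declared or used.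

* `forall_isSymm_mul_iff` — **TWIST LEMMA** (G2-DEFORM-SANITY C.2(c)): a matrix `ω` such that `ξ ω` is symmetric for
  EVERY symmetric `ξ` is scalar, and conversely.  Dictionary: `ω` = the matrix of `c₁(L) = Σ ω_ml dz_m ∧ dz̄_l` of a twist
  `L` of a governing component, `ξ ⌟ c₁(L) = Σ_{k<l} ((ξω)_kl − (ξω)_lk) dz̄_k ∧ dz̄_l`; so `(B_c, L_c)` survives all pp
  directions (`𝒢_G = K_n`) iff `c₁(L_c) ∈ K · b`: «b-twists are harmless and nothing else is — the line-bundle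
  version of non-separation».
* `siegel_sub_moduli` / `siegel_sub_moduli'` / `dim_siegel` / `jacobianExcess_pos_iff` — **(S-B)(b)**: `dim 𝒜_n − dim 𝓜_n
  = n(n+1)/2 − (3n−3) = C(n−2, 2)`, zero exactly at `n = 2, 3` (consistent with the genus-3 theorem [Mar25 Thm 8.3.1]),
  positive from `n = 4` on (`1, 3, 6` at `n = 4, 5, 6`) — the IDENTIFIED lower bound by which translate-type `W_{n−2}`
  designs at Jacobians miss Markman's window `n(n−1)` (STRUCTURE C7(b), red-4 v10: a LOWER bound, `κ_T, κ_Γ ≥ 0`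
  not evaluated; the deformation-theoretic input «`W_d` follows only `𝓜_g`» is Lombardi–Tirabassi Cor. 1.5, NOT used here).
* `jacobian_nc_iff` — the necessary condition (NC) «follows every pp direction» at a Jacobian anchor reads
  `C(g+1,2) ≤ 3g − 3`, i.e. `g ≤ 3`: ONE criterion, and the genus-3 theorem is its last case (G2-DEFORM-SANITY C.2(d)).
* `dressedPair_ker` — **(S-C) arithmetic shadow** (T-LEGO, `n = 3`, owner t-1): `6m + 21 − 27 = 6(m−1)`, zero iff `m = 1`.
* `eOne_reducible`, `eOne_eq_window_iff` — **(S-B)(e) / C7(a)**: `e₁^{Γ_tr}(F_d) = n + n(n−1) = n²` (`H¹(𝒪)·id` + the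
  constant branch shifts, L1(i)), equal to the window value `2n` only at `n = 2`.
* `hZeroTwo_weil` — the **Porteous row** (TH5 N″): `h^{0,2}` of an abelian `2n`-fold `= C(2n,2) = n(2n−1)` (`6, 15, 28,
  45` at `n = 2, …, 5`), the dimension of the target of the diagonal Atiyah obstruction.
References (dictionary only): G2-DEFORM-SANITY.md §C.2(c); STRUCTURE.md §1.1 C7(a)(b), §2 (S-B); N5-LEMMA-ROUTE-p1;
TH5-PORTEOUS-LEMMA-N.md; Lombardi–Tirabassi arXiv:1410.7986 Cor. 1.5 (dictionary only).
-/

open scoped BigOperators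
open Finset

namespace Summit.Ventures.HSemireg.ObstructionLocus

variable {K : Type*} [Field K] {n : ℕ}

/-! ## (S-B)(c) Twists: `ξ ⌟ c₁(L) = 0` for every pp direction `ξ` forces `c₁(L) ∈ K · b` -/

/-- **Twist lemma.** A matrix `ω` such that `ξ ω` is symmetric for EVERY symmetric `ξ` is scalar (and
conversely). Dictionary: `ω` = the matrix of `c₁(L) = Σ ω_ml dz_m ∧ dz̄_l`, `ξ ⌟ ω = Σ_{k<l} ((ξω)_kl − (ξω)_lk)
dz̄_k ∧ dz̄_l`; so a twist `L` of a governing component survives all pp directions iff `c₁(L) ∈ K · b`. -/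
theorem forall_isSymm_mul_iff (ω : Dir K n) :
    (∀ ξ : Dir K n, ξ.IsSymm → (ξ * ω).IsSymm) ↔ ∃ c : K, ω = c • (1 : Dir K n) := by
  constructor
  · intro h
    rcases Nat.eq_zero_or_pos n with hn | hn
    · subst hn
      exact ⟨0, Subsingleton.elim _ _⟩
    -- off-diagonal entries vanish
    have hoff : ∀ a b : Fin n, a ≠ b → ω a b = 0 := by
      intro a b hab
      have hs : (Matrix.single a a (1 : K)).IsSymm := by
        unfold Matrix.IsSymm; rw [Matrix.transpose_single]
      have := (h _ hs).apply a b
      -- (single a a 1 * ω) b a = (single a a 1 * ω) a b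
      rw [Matrix.single_mul_apply_of_ne (1 : K) a a b a (Ne.symm hab), Matrix.single_mul_apply_same, one_mul] at this
      exact this.symm
    -- diagonal entries agree
    have hdiag : ∀ a b : Fin n, ω a a = ω b b := by
      intro a b
      by_cases hab : a = b
      · rw [hab]
      have hs : (Matrix.single a b (1 : K) + Matrix.single b a 1).IsSymm := by
        unfold Matrix.IsSymm
        rw [Matrix.transpose_add, Matrix.transpose_single, Matrix.transpose_single, add_comm]
      have := (h _ hs).apply a b
      -- LHS = (ξω) b a = ω a a ; RHS = (ξω) a b = ω b b
      rw [Matrix.add_mul, Matrix.add_apply, Matrix.add_apply,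
        Matrix.single_mul_apply_of_ne (1 : K) a b b a (Ne.symm hab), Matrix.single_mul_apply_same,
        Matrix.single_mul_apply_same, Matrix.single_mul_apply_of_ne (1 : K) b a a b hab] at this
      simpa using this
    refine ⟨ω ⟨0, hn⟩ ⟨0, hn⟩, ?_⟩
    ext k l
    by_cases hkl : k = l
    · subst hkl
      simp [hdiag k ⟨0, hn⟩]
    · simp [Matrix.one_apply_ne hkl, hoff k l hkl]
  · rintro ⟨c, rfl⟩ ξ hξ
    rw [Matrix.mul_smul, Matrix.mul_one]
    exact hξ.smul c

/-! ## (S-B)(b),(e) and the Porteous row: the companion closed forms (arithmetic only) -/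

/-- `dim 𝒜_{m+2} − dim 𝓜_{m+2} = C(m+3, 2) − (3m + 3) = C(m, 2)`: the excess by which translate-type designs at
Jacobians of genus `n = m + 2` miss Markman's window — `0, 0, 1, 3, 6` at `n = 2, …, 6`. -/
theorem siegel_sub_moduli' (m : ℕ) : (m + 3).choose 2 = 3 * m + 3 + m.choose 2 := by
  -- Pascal for the triangular numbers, `C(j+1, 2) = j + C(j, 2)` (tree: `Literature.AlgebraicGeometry.Motives.choose_two_succ`)
  have key : ∀ j : ℕ, (j + 1).choose 2 = j + j.choose 2 := fun j => by
    rw [show 2 = 1 + 1 from rfl, Nat.choose_succ_succ, Nat.choose_one_right]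
  have h1 := key (m + 2)
  have h2 := key (m + 1)
  have h3 := key m
  rw [show m + 2 + 1 = m + 3 from rfl] at h1
  rw [show m + 1 + 1 = m + 2 from rfl] at h2
  omega

/-- The same in the genus variable `n ≥ 2`: `C(n+1, 2) = (3n − 3) + C(n−2, 2)`, i.e.
`dim 𝒜_n = dim 𝓜_n + C(n−2, 2)`. -/
theorem siegel_sub_moduli (hn : 2 ≤ n) : (n + 1).choose 2 = (3 * n - 3) + (n - 2).choose 2 := by
  obtain ⟨m, rfl⟩ := Nat.exists_eq_add_of_le hn
  have h := siegel_sub_moduli' m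
  rw [show 2 + m + 1 = m + 3 by ring, show 2 + m - 2 = m by omega]
  omega

/-- `dim 𝒜_n = n(n+1)/2 = C(n+1, 2)`. -/
theorem dim_siegel (n : ℕ) : n * (n + 1) / 2 = (n + 1).choose 2 := by
  rw [Nat.choose_two_right, Nat.add_sub_cancel, mul_comm]

/-- The Jacobian excess `C(n−2, 2)` is positive exactly from `n = 4` on (zero at `n = 2, 3`, matching the genus-3
theorem). -/
theorem jacobianExcess_pos_iff (n : ℕ) : 0 < (n - 2).choose 2 ↔ 4 ≤ n := by
  constructor
  · intro h
    by_contra h4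
    rw [Nat.choose_eq_zero_of_lt (by omega : n - 2 < 2)] at h
    exact lt_irrefl 0 h
  · intro h
    exact Nat.choose_pos (by omega)

/-- **(NC) at a Jacobian anchor ⟺ `g ≤ 3`.**  Curve-bound designs at `J(C)` follow exactly `T𝓜_g` (dimension `3g − 3`,
Lombardi–Tirabassi Cor. 1.5 — dictionary, not used); the necessary condition «follows every pp direction» needs
`dim 𝒜_g = C(g+1, 2) ≤ 3g − 3`, which holds iff `g ≤ 3` (`g ≥ 2`) — the genus-3 theorem is exactly the last case. -/
theorem jacobian_nc_iff (hn : 2 ≤ n) : (n + 1).choose 2 ≤ 3 * n - 3 ↔ n ≤ 3 := by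
  rw [siegel_sub_moduli hn]
  have h := jacobianExcess_pos_iff n
  constructor
  · intro hle
    by_contra hgt
    have : 0 < (n - 2).choose 2 := h.2 (by omega)
    omega
  · intro hle
    have : ¬ 0 < (n - 2).choose 2 := fun hpos => by have := h.1 hpos; omega
    omega

/-- **(S-C) arithmetic shadow** (T-LEGO, `n = 3`, owner t-1; quoted for completeness): the DRESSED-PAIR LAW
`h¹(N) = 6m + 21`, `rank π = 27` gives `ker π = 6(m − 1)`, zero exactly at `m = 1` («semiregular ⟺ m = 1»). -/
theorem dressedPair_ker (m : ℕ) (hm : 1 ≤ m) : 6 * m + 21 - 27 = 6 * (m - 1) ∧ (6 * (m - 1) = 0 ↔ m = 1) := by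
  constructor <;> omega

/-- `e₁` at the reducible point: `n` (from `H¹(𝒪)·id`) `+ n(n−1)` (constant branch shifts) `= n²`, which equals the
window value `2n` only at `n = 2`. -/
theorem eOne_reducible (n : ℕ) : n + n * (n - 1) = n * n := by
  rcases n with _ | n
  · simp
  · rw [Nat.add_sub_cancel]; ring

/-- `n² = 2n ⟺ n = 2` (`n ≥ 1`): the reducible-point `e₁` meets the window only in the STEP-0 dimension. -/
theorem eOne_eq_window_iff (hn : 1 ≤ n) : n * n = 2 * n ↔ n = 2 := by
  constructor
  · intro h; exact Nat.eq_of_mul_eq_mul_right hn h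
  · rintro rfl; rfl

/-- The Porteous row: `h^{0,2}` of an abelian `2n`-fold is `C(2n, 2) = n(2n − 1)` (`6, 15, 28, 45` at `n = 2..5`). -/
theorem hZeroTwo_weil (n : ℕ) : (2 * n).choose 2 = n * (2 * n - 1) := by
  rw [Nat.choose_two_right, mul_assoc, Nat.mul_div_cancel_left _ (by norm_num : 0 < 2)]

end Summit.Ventures.HSemireg.ObstructionLocus
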